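import Summits.ResolutionOfSingularities.ResolutionOfSingularities.Theorems.FrobeniusLadderFInjectiveMacaulayficationOmegaOneS2KNewtonKFanChecksHge2
import Summits.ResolutionOfSingularities.ResolutionOfSingularities.Theorems.FrobeniusLadderFInjectiveMacaulayficationOmegaOneS2KNewtonKCoverChecks
import Summits.ResolutionOfSingularities.ResolutionOfSingularities.Theorems.FrobeniusLadderFInjectiveMacaulayficationB9NewtonKFan
import HarnessLib

/-!
# BED Ω₁ REFINED CLASS MODEL X̃₂ = Bl_{K″} X_{B9} — THE BINDERS of ✓ `affineBlowup_fullCl_of_geomWeaklyNondegenerate` read off the kernel checks (K″ centre ALONE, g12 dialect):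
# fan side (`hV hgen hge hcov hm haA hv hprimAJ`) and NEWTON side (`hmin`: the common minimiser `u₀ c ∈ supp f_B9` of every chart)
# (crux `FInjectiveMacaulayfication` stmt-ResolutionOfSingularities-15315, chain w45a; Ω₁ GLOBAL PATCH F6 W1/W2, `g14/F6-ARCHITECTURE.md`; seat res-L1-w45a-stub-3 g14;
# data = `OmegaOneS2KNewtonK{FanTablesK0,FanTablesK1,FanTables,FanTablesB,NewtonTables,CoverRecords0p0–p4,CoverRecords0}`, kernel checks = `…FanChecks` / `…FanChecksHge1` / `…FanChecksHge2` / `…CoverChecks`)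

Support file for crux stmt-ResolutionOfSingularities-15315 (`FrobeniusLadder.FInjectiveMacaulayfication`), chain w45a.
[OURS · L1 W4.5a] — NOT a statement of any manuscript; AI-written (adapted from ✓ `B9NewtonKFan`, res-L1-w45a-stub-3 g12), weaker than expert review.

`f_B9 = z² + x⁹ + y⁹ + u⁹ + t⁹` (`(x,y,u,t,z) = (X 0,…,X 4)`, any field), centre `K″` with generator set `A := genSet 5 AL2` (`AL2 = KL2`: the 1223 vertices, the chart neighbours and five pure powers
of the support function `H_S2` of the global cure fan Σ₂ — 6032 generators), chart matrices `Vq c` (`= chartV 5 RAYS CL 1223 c`), vertices/neighbours `chartM/chartA 5 AL2 CL 1223`.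
§1 fan-side binders in the shape of `affineBlowup_fullCl_of_geomWeaklyNondegenerate` (soundness theorems of `FanCheckSound*` / `FanCheckMulti` / `FanCheckChunks`; `hcov` chunk by chunk via
✓ `FanCheckChunks.hcov_of_checkMultiL`); §2 ★ THE NEWTON SIDE (verbatim from `B9NewtonKFan`, `t = 1223`). No definitions, no named facts. [folklore; cite: CoxLittleSchenck2011, §2.3;
IshiiSingularities2018, proof of Lemma 4.4.24 (p. 96)]
-/

-- single-problem summit: the doubled namespace component is forced
set_option linter.dupNamespace false

noncomputable section

namespace Summit.ResolutionOfSingularities.ResolutionOfSingularities.Theorems.FInjectiveMacaulayfication.OmegaOneS2KNewtonKFan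

open MvPolynomial
open Summit.ResolutionOfSingularities.ResolutionOfSingularities.Theorems.FInjectiveMacaulayfication
open FanCheckKit FanCheckSound

/-! ## §1 Fan-side binders -/

/-- Every generator has length 5 (with the specimen-distinct conjunct `CL.length = 1223`). -/
theorem klen : (∀ b ∈ KL2.flatten, b.length = 5) ∧ CL.length = 1223 := by
  refine ⟨fun b hb => ?_, tlen⟩
  obtain ⟨ch, hch, hbch⟩ := List.mem_flatten.mp hb
  have h := List.all_eq_true.mp check_klen.1 ch hch
  exact allLen_spec h b hbch

/-- ★ THE CENTRE BINDERS: every generator involves a variable (`hAJ`), and pure powers of all variables lie in `A` (`hprim`). -/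
theorem hprimAJ : (∀ e ∈ genSet 5 AL2, ∃ j ∈ (Finset.univ : Finset (Fin 5)), 0 < e j) ∧
    (∀ j ∈ (Finset.univ : Finset (Fin 5)), ∃ N : ℕ, Finsupp.single j N ∈ genSet 5 AL2) ∧ CL.length = 1223 :=
  ⟨hAJ_of_check (n := 5) (r := 0) (AL2 := AL2) (RAYS := RAYS) (CL := CL) shapes.1 check_hAJ.1,
    hprim_of_check (n := 5) (r := 0) (AL2 := AL2) (RAYS := RAYS) (CL := CL) (PJ := PJ) shapes.1 check_hprim.1, tlen⟩

/-- The vertices are generators. -/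
theorem hm : ∀ c : Fin 1223, chartM 5 AL2 CL 1223 c ∈ genSet 5 AL2 := hm_of_shapes 5 0 AL2 RAYS CL 1223 shapes.1 tlen

/-- The neighbours are generators. -/
theorem haA : ∀ (c : Fin 1223) (i : Fin 5), chartA 5 AL2 CL 1223 c i ∈ genSet 5 AL2 := haA_of_shapes 5 0 AL2 RAYS CL 1223 shapes.1 tlen

/-- The chart matrices are unimodular. -/
theorem hV : ∀ c : Fin 1223, IsUnit (((Vq c).map (Nat.cast : ℕ → ℤ)).det) := fun c => by
  rw [hVq c]; exact hV_of_check 5 0 AL2 RAYS CL 1223 VinvTL shapes.1 tlen check_det.1 c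

/-- (hgen) `V_c a_c i = V_c m_c + e_i`. -/
theorem hgen : ∀ (c : Fin 1223) (i : Fin 5), (Finsupp.equivFunOnFinite.symm ((Vq c).mulVec ⇑(chartA 5 AL2 CL 1223 c i)) : Fin 5 →₀ ℕ) =
    Finsupp.equivFunOnFinite.symm ((Vq c).mulVec ⇑(chartM 5 AL2 CL 1223 c)) + Finsupp.single i 1 := fun c => by
  rw [hVq c]; exact hgen_of_check 5 0 AL2 RAYS CL 1223 shapes.1 tlen check_hgen.1 c

/-- (h≥) `m_c` minimises every row of `V_c` over `A`. -/
theorem hge : ∀ (c : Fin 1223), ∀ e ∈ genSet 5 AL2, (Finsupp.equivFunOnFinite.symm ((Vq c).mulVec ⇑(chartM 5 AL2 CL 1223 c)) : Fin 5 →₀ ℕ) ≤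
    Finsupp.equivFunOnFinite.symm ((Vq c).mulVec ⇑e) := fun c => by
  rw [hVq c]; exact hge_of_check 5 0 AL2 RAYS CL 1223 shapes.1 tlen check_hge.1 c

/-- `hcov`: the cover identities `(x^e)^K = x^(m c) · y`, `y ∈ I_A^(K-1)`, from the 2-vertex records, generator chunk by generator chunk. -/
theorem hcov (k : Type) [Field k] : ∀ e ∈ genSet 5 AL2, ∃ (c : Fin 1223) (K : ℕ), 1 ≤ K ∧
    ∃ y ∈ (Ideal.span ((fun b : Fin 5 →₀ ℕ => (MvPolynomial.monomial b (1 : k) : MvPolynomial (Fin 5) k)) '' (genSet 5 AL2 : Set (Fin 5 →₀ ℕ)))) ^ (K - 1),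
      (MvPolynomial.monomial e (1 : k) : MvPolynomial (Fin 5) k) ^ K = MvPolynomial.monomial (chartM 5 AL2 CL 1223 c) 1 * y := by
  intro e he
  -- `e = expOf 5 al` for some `al` in some chunk `AL2.getD i []`, `i < 121`
  rw [genSet, List.mem_toFinset] at he
  obtain ⟨al, hal, rfl⟩ := List.mem_map.mp he
  obtain ⟨ch, hch, halch⟩ := List.mem_flatten.mp hal
  obtain ⟨i, hi, hgi⟩ := exists_getL_eq_of_mem AL2 [] hch
  have hlen : AL2.length = 121 := al2_len.1
  have hgetD : AL2.getD i [] = ch := by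
    rw [List.getD_eq_getElem?_getD, List.getElem?_eq_getElem (by omega), Option.getD_some]
    have := getL_eq_getElem AL2 i [] hi
    rw [← this, hgi]
  have hchk := check_hcov_chunks i (by omega)
  rw [hgetD] at hchk
  exact FanCheckChunks.hcov_of_checkMultiL k AL2 MV2 RAYS CL 50 1223 ch (RLM2_0.getD i []) shapes.1 tlen check_mvbridge hchk al halch

/-- `hv`: the vertex monomials lie in the image of `I_A` modulo any ideal `F`. -/
theorem hv (k : Type) [Field k] (F : Ideal (MvPolynomial (Fin 5) k)) (c : Fin 1223) :
    Ideal.Quotient.mk F (monomial (chartM 5 AL2 CL 1223 c) (1 : k)) ∈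
      Ideal.span ((fun e : Fin 5 →₀ ℕ => Ideal.Quotient.mk F (monomial e (1 : k))) '' (genSet 5 AL2 : Set (Fin 5 →₀ ℕ))) :=
  Ideal.subset_span ⟨_, Finset.mem_coe.mpr (hm c), rfl⟩

/-! ## §2 ★ The Newton side: the support of `f_B9` and the common minimisers (as in ✓ `B9NewtonKFan`, `t = 1223`) -/

/-- The tabulated minimiser of chart `c` as an exponent: `u₀ c = U0 c` read as a finsupp. -/
theorem coe_u0 (c : Fin 1223) : ⇑(Finsupp.equivFunOnFinite.symm (U0 c) : Fin 5 →₀ ℕ) = U0 c := Finsupp.coe_equivFunOnFinite_symm _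

/-- The Newton support table of the X̃₂ tables is the one of ✓ `B9NewtonKTables` (same literal). [plumbing] -/
theorem suppv_eq : SUPPv = B9NewtonKFan.SUPPv := rfl

/-- ★ Every tabulated minimiser is a support vector of `f_B9`. -/
theorem hu₀ (k : Type) [Field k] (f : MvPolynomial (Fin 5) k) (hf : f = X 4 ^ 2 + X 0 ^ 9 + X 1 ^ 9 + X 2 ^ 9 + X 3 ^ 9) (c : Fin 1223) :
    (Finsupp.equivFunOnFinite.symm (U0 c) : Fin 5 →₀ ℕ) ∈ f.support := by
  obtain ⟨s4, s0, s1, s2, s3⟩ := B9NewtonKFan.single_mem_support k f hf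
  have hmem := (B9NewtonKFan.mem_SUPPv_iff (U0 c)).mp (suppv_eq ▸ hU0_mem c)
  have conv : ∀ u : Fin 5 →₀ ℕ, U0 c = ⇑u → (Finsupp.equivFunOnFinite.symm (U0 c) : Fin 5 →₀ ℕ) = u := fun u hu =>
    DFunLike.coe_injective (by rw [coe_u0, hu])
  rcases hmem with h | h | h | h | h <;> rw [conv _ h]
  exacts [s4, s0, s1, s2, s3]

/-- ★★ **THE NEWTON BINDER `hmin`** on the 1223 charts of X̃₂. [folklore; cite: IshiiSingularities2018, proof of Lemma 4.4.24 (p. 96)] -/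
theorem hmin (k : Type) [Field k] (f : MvPolynomial (Fin 5) k) (hf : f = X 4 ^ 2 + X 0 ^ 9 + X 1 ^ 9 + X 2 ^ 9 + X 3 ^ 9) (c : Fin 1223) :
    ∀ i : Fin 5, ∀ u ∈ f.support, ∑ j, Vq c i j * (Finsupp.equivFunOnFinite.symm (U0 c) : Fin 5 →₀ ℕ) j ≤ ∑ j, Vq c i j * u j := by
  intro i u hu
  have hu' : (⇑u : Fin 5 → ℕ) ∈ SUPPv := by
    rw [suppv_eq, B9NewtonKFan.mem_SUPPv_iff]
    rcases B9NewtonKFan.support_subset k f hf u hu with h | h | h | h | h <;> simp [h]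
  have key := hmin_raw c i (⇑u) hu'
  simpa only [Fin.sum_univ_five, coe_u0] using key

end Summit.ResolutionOfSingularities.ResolutionOfSingularities.Theorems.FInjectiveMacaulayfication.OmegaOneS2KNewtonKFan

end
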